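import Literature.MathematicalPhysics.QuantumManyBody.BoseGasSlabBracketing
import Literature.MathematicalPhysics.QuantumManyBody.BoseGasEnergyDensityConvexity
import Literature.MathematicalPhysics.QuantumManyBody.BoseGasCrowdedCellPenalty
import HarnessLib

/-!
# Wall depletion of Dirichlet near-minimisers: the deterministic core estimate

Topic `Literature/MathematicalPhysics/QuantumManyBody`, namespace `…BoseGas`; combines
`BoseGasSlabBracketing.lean` (IMS split of a Dirichlet state of `Λ_{L'}` into a bulk piece and an
upper layer of thickness `ℓ` below the right wall in direction `a`, Neumann cells of side `ℓ` for
the layer, an unconstrained Dirichlet group for the bulk; weights `w(σ, lam)`),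
`BoseGasEnergyDensityConvexity.lean` (the supporting line of the convex energy density under the
Dirichlet bulk group) and a linear crowding penalty for the Neumann cells (hypothesis `hpen`, as
supplied by `BoseGasCrowdedCellPenalty.lean`) into ONE inequality, `slab_le_of_bracketing`:

if a Dirichlet trial state `Φ` of `N` particles in `Λ_{L'}` has energy
`≤ N (e⁺(ρ⋆) + 2ε) + 1`, `ρ⋆ = N/(L'+2R)³ ≤ ρ`, and the chord slope of the energy density up to
`2ρ` is below a quarter of the penalty rate `P`, then for `0 < s ≤ 1` the expected number of
particles within `s` of the right wall obeys
`∑ⱼ ∫_{x_{j,a} > L'-s} |Φ|² ≤ (4/(3P)) (2εN + 1 + N (π²/(4δ))² + 4Pρ_h ℓ₀ L'²)` —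
the four terms being the energy slack, the near-minimality slack, the IMS localisation error for a
ramp of width `δ`, and the penalty offsets of the `≤ K²` top cells (`K = ⌊L'/ℓ₀⌋`, cell side
`ℓ = L'/K ∈ [ℓ₀, 2ℓ₀)`).  Mechanism: every piece `(σ, lam)` of positive weight has floor
`E₀^D(N - m, L') + ∑_c E₀^Neu(n_c, ℓ) ≥ N e⁺(ρ⋆) - mS + Pm - K²·offset` with `m = #upper particles`,
`S ≤ P/4`; the floors are paid for by `⟨Φ,HΦ⟩ + N(π²/(4δ))²`, and the slab is covered by the upper
pieces.  The thermodynamic (`o(N)`) smallness of the right side is extracted in the companion file.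
No definitions.

## References

* [LSSY2005] E. H. Lieb, R. Seiringer, J. P. Solovej, J. Yngvason, *The Mathematics of the Bose
  Gas and its Condensation* (2005), Thm. 2.4 and (2.52)–(2.58).
* [Ruelle1969] D. Ruelle, *Statistical Mechanics: Rigorous Results* (1969), §3.5.
-/

noncomputable section

namespace Literature.MathematicalPhysics.QuantumManyBody.BoseGas

open _root_.MeasureTheory _root_.Filter _root_.Set
open scoped ENNReal NNReal Topology BigOperators

variable {v : ℝ → ℝ≥0∞}

/-- The number of bulk plus the number of upper particles is `N`. [folklore] -/
theorem card_filter_eq_zero_add_card_filter_eq_one {N : ℕ} (σ : Fin N → Fin 2) :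
    (Finset.univ.filter fun j => σ j = 0).card + (Finset.univ.filter fun j => σ j = 1).card = N := by
  have h := Finset.card_filter_add_card_filter_not (s := Finset.univ) (fun j : Fin N => σ j = 0)
  have h1 : (Finset.univ.filter fun j : Fin N => ¬ σ j = 0) = Finset.univ.filter fun j => σ j = 1 := by
    ext j
    simp only [Finset.mem_filter, Finset.mem_univ, true_and]
    constructor
    · intro hj; rcases Fin.exists_fin_two.1 ⟨σ j, rfl⟩ with h | h
      · exact absurd h hj
      · exact h
    · intro hj; rw [hj]; decide
  rw [h1] at h
  simpa using h

/-- The cell number: for `L' ≥ 2ℓ₀ > 0`, `K = ⌊L'/ℓ₀⌋ ≥ 1` and `ℓ = L'/K ∈ [ℓ₀, 2ℓ₀]`. [folklore] -/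
theorem floor_cells {L' ℓ₀ : ℝ} (hℓ₀ : 0 < ℓ₀) (hL' : 2 * ℓ₀ ≤ L') :
    0 < ⌊L' / ℓ₀⌋₊ ∧ ℓ₀ ≤ L' / ⌊L' / ℓ₀⌋₊ ∧ L' / ⌊L' / ℓ₀⌋₊ ≤ 2 * ℓ₀ := by
  have hx : 2 ≤ L' / ℓ₀ := by rw [le_div_iff₀ hℓ₀]; linarith
  have hK2 : 2 ≤ ⌊L' / ℓ₀⌋₊ := (Nat.le_floor_iff (by positivity)).2 (by exact_mod_cast hx)
  have hKpos : 0 < ⌊L' / ℓ₀⌋₊ := by omega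
  have hKr : (0 : ℝ) < ⌊L' / ℓ₀⌋₊ := Nat.cast_pos.2 hKpos
  have hfl : (⌊L' / ℓ₀⌋₊ : ℝ) ≤ L' / ℓ₀ := Nat.floor_le (by positivity)
  have hfl' : L' / ℓ₀ < ⌊L' / ℓ₀⌋₊ + 1 := Nat.lt_floor_add_one _
  refine ⟨hKpos, ?_, ?_⟩
  · rw [le_div_iff₀ hKr]
    calc ℓ₀ * ⌊L' / ℓ₀⌋₊ ≤ ℓ₀ * (L' / ℓ₀) := mul_le_mul_of_nonneg_left hfl hℓ₀.le
      _ = L' := by field_simp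
  · rw [div_le_iff₀ hKr]
    have h1 : L' < ℓ₀ * (⌊L' / ℓ₀⌋₊ + 1) := by
      have := mul_lt_mul_of_pos_left hfl' hℓ₀
      rwa [mul_div_cancel₀ _ hℓ₀.ne'] at this
    have h2 : (2 : ℝ) ≤ ⌊L' / ℓ₀⌋₊ := by exact_mod_cast hK2
    nlinarith

/-- **The core slab estimate.**  Let `v` be repulsive of finite range `R > 0`, `ofReal ρ̄ ≤ ρ_c(v)`,
and let `P, ρ_h, ℓ₁` be a crowding penalty for the Neumann cells
(`ofReal (P n) ≤ E₀^Neu(n, ℓ) + ofReal (P·2ρ_hℓ³)` for `ℓ ≥ ℓ₁`).  Let `N ≥ 1`, `δ ≥ 1`,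
`ℓ₀ ≥ max ℓ₁ (δ + 2)`, `L' ≥ 2ℓ₀`, `s ≤ 1`, `ε ≥ 0`, and a density `ρ` with
`ρ⋆ := N/(L'+2R)³ ≤ ρ`, `2ρ < ρ̄` and `2 e⁺(2ρ) ≤ P/4`.  Then every Dirichlet trial state `Φ` of
`Λ_{L'}` with `⟨Φ,HΦ⟩ ≤ N(e⁺(ρ⋆) + 2ε) + 1` has
`∑ⱼ ∫_{x_{j,a} > L'-s} |Φ|² ≤ (4/(3P)) (2εN + 1 + N(π²/(4δ))² + 4Pρ_hℓ₀L'²)` for every direction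
`a`. [cite: LSSY2005, Thm. 2.4 and (2.52)–(2.58); Ruelle1969, §3.5.11] -/
theorem slab_le_of_bracketing (hv : IsRepulsiveFiniteRange v) {R : ℝ} (hR : 0 < R)
    (hv0 : ∀ r, R < r → v r = 0) {ρbar : ℝ} (hcap : ENNReal.ofReal ρbar ≤ criticalDensity v)
    {P ρh ℓ₁ : ℝ} (hP : 0 < P) (hρh : 0 < ρh)
    (hpen : ∀ ℓ : ℝ, ℓ₁ ≤ ℓ → ∀ n : ℕ, ENNReal.ofReal (P * n) ≤
      neumannGroundStateEnergy v n ℓ + ENNReal.ofReal (P * (2 * ρh * ℓ ^ 3)))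
    {N : ℕ} (hN : 0 < N) {L' ℓ₀ δ s ρ ε : ℝ} (hδ : 1 ≤ δ) (hℓ₀1 : ℓ₁ ≤ ℓ₀) (hℓ₀δ : δ + 2 ≤ ℓ₀)
    (hL' : 2 * ℓ₀ ≤ L') (hs1 : s ≤ 1) (hε : 0 ≤ ε)
    (hρ : (N : ℝ) / (L' + 2 * R) ^ 3 ≤ ρ) (h2ρ : 2 * ρ < ρbar)
    (hD : 2 * (limsupEnergyPerParticle v (2 * ρ)).toReal ≤ P / 4)
    (Φ : TrialState N L')
    (hΦ : energy v Φ ≤ ENNReal.ofReal (N * ((limsupEnergyPerParticle v (N / (L' + 2 * R) ^ 3)).toReal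
      + 2 * ε)) + 1) (a : Fin 3) :
    (∑ j : Fin N, ∫⁻ X in {X : Config N | L' - s < X j a}, ((‖Φ.ψ X‖₊ : ℝ≥0∞)) ^ 2) ≤
      ENNReal.ofReal (4 / (3 * P) * (2 * ε * N + 1 + N * (Real.pi ^ 2 / (4 * δ)) ^ 2 +
        4 * P * ρh * ℓ₀ * L' ^ 2)) := by
  -- geometry of the cells
  have hℓ₀ : 0 < ℓ₀ := by linarith
  have hL'0 : 0 < L' := by linarith
  obtain ⟨hK, hℓlo, hℓhi⟩ := floor_cells hℓ₀ hL'
  set K : ℕ := ⌊L' / ℓ₀⌋₊ with hKdef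
  set ℓ : ℝ := L' / K with hℓdef
  have hKr : (0 : ℝ) < K := Nat.cast_pos.2 hK
  have hℓ : 0 < ℓ := lt_of_lt_of_le hℓ₀ hℓlo
  have hKℓ : (K : ℝ) * ℓ = L' := by rw [hℓdef]; field_simp
  have hℓ₁ℓ : ℓ₁ ≤ ℓ := hℓ₀1.trans hℓlo
  -- the profile pair across the ramp `[L' - ℓ, L' - ℓ + δ]`
  have hδ0 : 0 < δ := by linarith
  obtain ⟨c, hc, h01, hsq, horth, hder, hc1, hc0⟩ := exists_splitProfile (L' - ℓ) hδ0
  have hslab : L' - ℓ + δ ≤ L' - s := by linarith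
  -- densities and the supporting line
  set e : ℝ → ℝ := fun x => (limsupEnergyPerParticle v x).toReal with he_def
  set ρs : ℝ := N / (L' + 2 * R) ^ 3 with hρs
  have hNr : (0 : ℝ) < N := Nat.cast_pos.2 hN
  have hρs0 : 0 < ρs := by positivity
  have hρpos : 0 < ρ := hρs0.trans_le hρ
  set z : ℝ := 2 * ρ with hz
  have hρsz : ρs < z := by rw [hz]; linarith
  set S : ℝ := (z * e z - ρs * e ρs) / (z - ρs) with hS
  have heS0 : 0 ≤ e ρs := ENNReal.toReal_nonneg
  have hez0 : 0 ≤ e z := ENNReal.toReal_nonneg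
  have hSle : S ≤ P / 4 := by
    have h1 : S ≤ z * e z / (z - ρs) := by
      rw [hS]; exact div_le_div_of_nonneg_right (by nlinarith) (by linarith)
    have h2 : z * e z / (z - ρs) ≤ 2 * e z := by
      rw [div_le_iff₀ (by linarith), hz]; nlinarith
    exact h1.trans (h2.trans hD)
  -- abbreviations for the pieces
  set W : (Fin N → Fin 2) → Config N → ℂ := fun σ X =>
    Φ.ψ X * ((∏ j, c (σ j) (X j a) : ℝ) : ℂ) with hW
  set Rg : (Fin N → Fin (K ^ 3 + 1)) → Set (Config N) := fun lam =>
    {X : Config N | ∀ j (c' : Fin (K ^ 3)), lam j = c'.castSucc → X j - cellCorner K ℓ c' ∈ box ℓ}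
    with hRg
  set w : (Fin N → Fin 2) → (Fin N → Fin (K ^ 3 + 1)) → ℝ≥0∞ := fun σ lam =>
    ∫⁻ X in Rg lam, ((‖W σ X‖₊ : ℝ≥0∞)) ^ 2 with hw
  set fib : (Fin N → Fin 2) → Finset (Fin N → Fin (K ^ 3 + 1)) := fun σ =>
    Finset.univ.filter (fun lam : Fin N → Fin (K ^ 3 + 1) => ∀ j, lam j = Fin.last _ ↔ σ j = 0)
    with hfib
  set m : (Fin N → Fin 2) → ℕ := fun σ => (Finset.univ.filter fun j => σ j = 1).card with hm
  set floor : (Fin N → Fin (K ^ 3 + 1)) → ℝ≥0∞ := fun lam =>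
    groundStateEnergy v (Finset.univ.filter fun i => lam i = Fin.last _).card L' +
      ∑ c' : Fin (K ^ 3), neumannGroundStateEnergy v
        (Finset.univ.filter fun i => lam i = c'.castSucc).card ℓ with hfloor
  set off : ℝ := P * (2 * ρh * ℓ ^ 3) with hoff
  have hoff0 : 0 ≤ off := by positivity
  -- the three facts from the bracketing file
  have hw1 : ∑ σ, ∑ lam ∈ fib σ, w σ lam = 1 :=
    sum_sum_weight_eq_one hℓ hK hKℓ hc hsq a Φ
  have hw2 : ∑ σ, ∑ lam ∈ fib σ, floor lam * w σ lam ≤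
      energy v Φ + N * ENNReal.ofReal ((Real.pi ^ 2 / (4 * δ)) ^ 2) :=
    sum_sum_floor_mul_weight_le hℓ hK hKℓ hc hsq horth hder a hv.1 Φ
  have hw3 : (∑ j : Fin N, ∫⁻ X in {X : Config N | L' - s < X j a}, ((‖Φ.ψ X‖₊ : ℝ≥0∞)) ^ 2) ≤
      ∑ σ, (m σ : ℝ≥0∞) * ∑ lam ∈ fib σ, w σ lam :=
    slab_le_sum_card_mul_sum_weight hℓ hK hKℓ hc hsq hc0 a Φ hslab
  -- the floor of a piece of positive weight
  have hpiece : ∀ σ, ∀ lam ∈ fib σ, w σ lam ≠ 0 →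
      ENNReal.ofReal (N * e ρs + 3 * P / 4 * m σ) ≤ floor lam + (K : ℝ≥0∞) ^ 2 * ENNReal.ofReal off := by
    intro σ lam hlam hwne
    have hlam' : ∀ j, lam j = Fin.last _ ↔ σ j = 0 := (Finset.mem_filter.1 hlam).2
    -- bulk: supporting line
    have hnB : (Finset.univ.filter fun i => lam i = Fin.last _).card =
        (Finset.univ.filter fun j => σ j = 0).card := by
      congr 1; ext i; simp [hlam' i]
    have hmN : ((Finset.univ.filter fun j => σ j = 0).card : ℝ) = N - m σ := by
      have := card_filter_eq_zero_add_card_filter_eq_one σ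
      rw [hm]
      have h' : ((Finset.univ.filter fun j => σ j = 0).card : ℝ) +
          ((Finset.univ.filter fun j => σ j = 1).card : ℝ) = N := by exact_mod_cast this
      linarith
    have hbulk : ENNReal.ofReal (N * e ρs - (m σ : ℝ) * S) ≤
        groundStateEnergy v (Finset.univ.filter fun i => lam i = Fin.last _).card L' := by
      have h := ofReal_tangent_le_groundStateEnergy hv hR hv0 hcap hN
        (n := (Finset.univ.filter fun j => σ j = 0).card)
        (by have := card_filter_eq_zero_add_card_filter_eq_one σ; omega)
        hL'0 hρsz h2ρ
      rw [hnB]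
      refine le_trans (le_of_eq ?_) h
      congr 1
      rw [hmN]
      simp only [hS, he_def]
      ring
    -- layer: the penalty over the top cells
    have htop := fun j hj => topLayer_of_weight_ne_zero hℓ hKℓ hc1 a Φ.ψ hlam' hwne (j := j) hj
    have hcount := sum_card_topCells_eq_card hlam' a htop
    have hlayer : ENNReal.ofReal (P * m σ) ≤
        (∑ c' : Fin (K ^ 3), neumannGroundStateEnergy v
          (Finset.univ.filter fun i => lam i = c'.castSucc).card ℓ) +
          (K : ℝ≥0∞) ^ 2 * ENNReal.ofReal off := by
      have h := ofReal_mul_sum_le_sum_add_card_mul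
        (Finset.univ.filter fun c' : Fin (K ^ 3) => (cellCoord K c' a : ℕ) + 1 = K)
        (fun c' => (Finset.univ.filter fun i => lam i = c'.castSucc).card)
        (fun n => neumannGroundStateEnergy v n ℓ) hP.le (hpen ℓ hℓ₁ℓ)
      rw [← Nat.cast_sum, hcount] at h
      refine h.trans (add_le_add ?_ ?_)
      · exact Finset.sum_le_sum_of_subset_of_nonneg (Finset.filter_subset _ _) fun _ _ _ => bot_le
      · gcongr
        exact_mod_cast card_topCells_le K a
    -- combine
    have hsum : N * e ρs + 3 * P / 4 * m σ ≤ (N * e ρs - (m σ : ℝ) * S) + P * m σ := by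
      have : (m σ : ℝ) * S ≤ (m σ : ℝ) * (P / 4) := mul_le_mul_of_nonneg_left hSle (Nat.cast_nonneg _)
      linarith
    calc ENNReal.ofReal (N * e ρs + 3 * P / 4 * m σ)
        ≤ ENNReal.ofReal ((N * e ρs - (m σ : ℝ) * S) + P * m σ) := ENNReal.ofReal_le_ofReal hsum
      _ ≤ ENNReal.ofReal (N * e ρs - (m σ : ℝ) * S) + ENNReal.ofReal (P * m σ) := ENNReal.ofReal_add_le
      _ ≤ groundStateEnergy v (Finset.univ.filter fun i => lam i = Fin.last _).card L' +
          ((∑ c' : Fin (K ^ 3), neumannGroundStateEnergy v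
            (Finset.univ.filter fun i => lam i = c'.castSucc).card ℓ) +
            (K : ℝ≥0∞) ^ 2 * ENNReal.ofReal off) := add_le_add hbulk hlayer
      _ = floor lam + (K : ℝ≥0∞) ^ 2 * ENNReal.ofReal off := by rw [hfloor]; ring
  -- multiply by the weights and sum
  have hmain : ENNReal.ofReal (N * e ρs) + ENNReal.ofReal (3 * P / 4) * ∑ σ, ∑ lam ∈ fib σ,
      (m σ : ℝ≥0∞) * w σ lam ≤
      (∑ σ, ∑ lam ∈ fib σ, floor lam * w σ lam) + (K : ℝ≥0∞) ^ 2 * ENNReal.ofReal off := by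
    have hterm : ∀ σ, ∀ lam ∈ fib σ,
        ENNReal.ofReal (N * e ρs + 3 * P / 4 * m σ) * w σ lam ≤
          floor lam * w σ lam + (K : ℝ≥0∞) ^ 2 * ENNReal.ofReal off * w σ lam := by
      intro σ lam hlam
      by_cases hwz : w σ lam = 0
      · simp [hwz]
      · rw [← add_mul]
        exact mul_le_mul_left (hpiece σ lam hlam hwz) _
    have hsplit : ∀ σ lam, ENNReal.ofReal (N * e ρs + 3 * P / 4 * m σ) * w σ lam =
        ENNReal.ofReal (N * e ρs) * w σ lam + ENNReal.ofReal (3 * P / 4) * ((m σ : ℝ≥0∞) * w σ lam) := by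
      intro σ lam
      rw [ENNReal.ofReal_add (by positivity) (by positivity),
        ENNReal.ofReal_mul (p := 3 * P / 4) (by positivity), ENNReal.ofReal_natCast]
      ring
    calc ENNReal.ofReal (N * e ρs) + ENNReal.ofReal (3 * P / 4) * ∑ σ, ∑ lam ∈ fib σ,
          (m σ : ℝ≥0∞) * w σ lam
        = ∑ σ, ∑ lam ∈ fib σ, ENNReal.ofReal (N * e ρs + 3 * P / 4 * m σ) * w σ lam := by
          simp_rw [hsplit, Finset.sum_add_distrib, ← Finset.mul_sum, hw1, mul_one]
      _ ≤ ∑ σ, ∑ lam ∈ fib σ, (floor lam * w σ lam + (K : ℝ≥0∞) ^ 2 * ENNReal.ofReal off * w σ lam) :=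
          Finset.sum_le_sum fun σ _ => Finset.sum_le_sum fun lam hlam => hterm σ lam hlam
      _ = (∑ σ, ∑ lam ∈ fib σ, floor lam * w σ lam) + (K : ℝ≥0∞) ^ 2 * ENNReal.ofReal off := by
          simp_rw [Finset.sum_add_distrib, ← Finset.mul_sum, hw1, mul_one]
  -- the energy budget: cancel `N e(ρ⋆)`
  have hbudget : ENNReal.ofReal (3 * P / 4) * ∑ σ, ∑ lam ∈ fib σ, (m σ : ℝ≥0∞) * w σ lam ≤
      ENNReal.ofReal (2 * ε * N) + 1 + N * ENNReal.ofReal ((Real.pi ^ 2 / (4 * δ)) ^ 2) +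
        (K : ℝ≥0∞) ^ 2 * ENNReal.ofReal off := by
    have h1 := hmain.trans (add_le_add hw2 le_rfl)
    have h2 : energy v Φ ≤ ENNReal.ofReal (N * e ρs) + (ENNReal.ofReal (2 * ε * N) + 1) := by
      refine hΦ.trans (le_of_eq ?_)
      rw [show (N : ℝ) * (e ρs + 2 * ε) = N * e ρs + 2 * ε * N by ring,
        ENNReal.ofReal_add (by positivity) (by positivity), add_assoc]
    have h3 := h1.trans (add_le_add (add_le_add h2 le_rfl) le_rfl)
    rw [add_assoc, add_assoc, ENNReal.add_le_add_iff_left ENNReal.ofReal_ne_top] at h3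
    calc _ ≤ _ := h3
      _ = _ := by ring
  -- the offsets of the top cells: `K² · P · 2ρ_h ℓ³ ≤ 4Pρ_hℓ₀L'²`
  have hK2off : (K : ℝ) ^ 2 * off ≤ 4 * P * ρh * ℓ₀ * L' ^ 2 := by
    rw [hoff]
    have h1 : (K : ℝ) ^ 2 * (P * (2 * ρh * ℓ ^ 3)) = 2 * P * ρh * ((K : ℝ) * ℓ) ^ 2 * ℓ := by ring
    rw [h1, hKℓ]
    have : 2 * P * ρh * L' ^ 2 * ℓ ≤ 2 * P * ρh * L' ^ 2 * (2 * ℓ₀) :=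
      mul_le_mul_of_nonneg_left hℓhi (by positivity)
    linarith
  -- conclusion
  have h34 : (0 : ℝ) < 3 * P / 4 := by positivity
  calc (∑ j : Fin N, ∫⁻ X in {X : Config N | L' - s < X j a}, ((‖Φ.ψ X‖₊ : ℝ≥0∞)) ^ 2)
      ≤ ∑ σ, ∑ lam ∈ fib σ, (m σ : ℝ≥0∞) * w σ lam := by
        refine hw3.trans (le_of_eq ?_)
        simp_rw [Finset.mul_sum]
    _ = ENNReal.ofReal (4 / (3 * P)) * (ENNReal.ofReal (3 * P / 4) *
          ∑ σ, ∑ lam ∈ fib σ, (m σ : ℝ≥0∞) * w σ lam) := by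
        rw [← mul_assoc, ← ENNReal.ofReal_mul (by positivity),
          show 4 / (3 * P) * (3 * P / 4) = 1 by field_simp, ENNReal.ofReal_one, one_mul]
    _ ≤ ENNReal.ofReal (4 / (3 * P)) * (ENNReal.ofReal (2 * ε * N) + 1 +
          N * ENNReal.ofReal ((Real.pi ^ 2 / (4 * δ)) ^ 2) + (K : ℝ≥0∞) ^ 2 * ENNReal.ofReal off) :=
        mul_le_mul_right hbudget _
    _ ≤ ENNReal.ofReal (4 / (3 * P)) * ENNReal.ofReal (2 * ε * N + 1 + N * (Real.pi ^ 2 / (4 * δ)) ^ 2 +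
          4 * P * ρh * ℓ₀ * L' ^ 2) := by
        gcongr
        rw [ENNReal.ofReal_add (by positivity) (by positivity),
          ENNReal.ofReal_add (by positivity) (by positivity),
          ENNReal.ofReal_add (by positivity) (by positivity), ENNReal.ofReal_one,
          ENNReal.ofReal_mul (Nat.cast_nonneg _), ENNReal.ofReal_natCast]
        gcongr
        calc (K : ℝ≥0∞) ^ 2 * ENNReal.ofReal off = ENNReal.ofReal ((K : ℝ) ^ 2 * off) := by
              rw [← ENNReal.ofReal_natCast (n := K), ← ENNReal.ofReal_pow (Nat.cast_nonneg _),
                ← ENNReal.ofReal_mul (by positivity)]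
          _ ≤ ENNReal.ofReal (4 * P * ρh * ℓ₀ * L' ^ 2) := ENNReal.ofReal_le_ofReal hK2off
    _ = _ := by rw [← ENNReal.ofReal_mul (by positivity)]

end Literature.MathematicalPhysics.QuantumManyBody.BoseGas

end
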